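import Summits.Parity.BatemanHorn.Theses.RoughValueTransport
import Literature.NumberTheory.Sieve.BatemanHornStaggeredSieveProduct
import HarnessLib

/-!
# Route `RoughValueTransport`, crux `RoughValueLaw` (stmt-Parity-11390), line
# `increment-anchoring`: the registered stub `stub_mertensAlongSystem`

`--supports` file of the checked skeleton
`Summits/Parity/BatemanHorn/Cruxes/RoughValueLaw/Lines/increment-anchoring.lean`
(crux `Summit.Parity.BatemanHorn.Theses.RoughValueTransport.RoughValueLaw`).  It PROVES the
registered stub `stub_mertensAlongSystem` (S1b, the MERTENS half of the line's calibration at large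
depth), verbatim: for every Bateman–Horn system `f = (f₁, …, f_k)` and every fixed depth
`U ≥ ∑ᵢ deg fᵢ`,
`V_f(x,U) · (log x)^k → (C(f)/∏ deg fᵢ) · e^{−kγ} · U^k` as `x → ∞` along `ℕ`, where
`V_f(x,U) = ∏_{p ≤ x} (1 − ω_p(x)/p)`, `ω_p(x) = #{r mod p : ∃ i, p < x^{deg fᵢ/U} ∧ p ∣ fᵢ(r)}` and
`C(f) = batemanHornConst f`.  Everything used is PROVED in the tree; no definition and no new fact
is introduced.

## The argument (sub-namespace `MertensAlongSystem`; generic lemmas in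
`Literature/NumberTheory/Sieve/BatemanHornMertensProduct.lean` and
`Literature/NumberTheory/Sieve/BatemanHornStaggeredSieveProduct.lean`,
namespace `BatemanHornMertens`)

Write `zᵢ = x^{dᵢ/U}` (`dᵢ = deg fᵢ ≥ 1`, so `zᵢ ≤ x`), `mᵢ = ⌈zᵢ⌉₊ − 1` (the primes `≤ mᵢ` are the
primes `< zᵢ`), and let `i₀` minimise `dᵢ`.

1. (`prod_one_sub_card_div_eq`) exact decomposition
   `V = [∏_{p ≤ m_{i₀}} (1 − ω_f(p)/p)] · ∏ᵢ [Pᵢ(mᵢ)/Pᵢ(m_{i₀})] · E(x)`,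
   `Pᵢ(n) = ∏_{p ≤ n}(1 − ρᵢ(p)/p)`, `E(x)` the product over the primes `m_{i₀} < p ≤ x` of
   `c_p = (1 − ω_p(x)/p)/∏_{i : p < zᵢ}(1 − ρᵢ(p)/p)` (below `z_{i₀}` every coordinate is sifted and
   `ω_p(x) = ω_f(p)`).
2. (`tendsto_log_pow_mul_prod_one_sub_rootCount`, Mertens along `f`: Bateman–Horn partial products
   `→ C(f)` by `IsBatemanHornSystem.hasBatemanHornConst_holds`, times Mertens' third theorem
   `tendsto_log_mul_prod_one_sub_inv_nat`; transported to the threshold `m_{i₀}`, where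
   `log m_{i₀}/log x → d_{i₀}/U`):
   `(log x)^k ∏_{p ≤ m_{i₀}}(1 − ω_f(p)/p) → C(f)e^{−kγ}(U/d_{i₀})^k`.
3. (Mertens for the single systems `![fᵢ]`, `isBatemanHornSystem_single`):
   `Pᵢ(mᵢ)/Pᵢ(m_{i₀}) → d_{i₀}/dᵢ`.
4. (`corr_prod_bounds`) beyond the primes `P₀` of
   `IsBatemanHornSystem.exists_polyRootCountMod_eq_sum` one has `ω_p(x) = ∑_{i : p < zᵢ} ρᵢ(p)`,
   so `c_p = 1 + O((∑dᵢ)²/p²)` and `1 − 4(∑dᵢ)²/(m_{i₀} + 1) ≤ E(x) ≤ 1`, hence `E(x) → 1`.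
5. Product of the limits: `(U/d_{i₀})^k · ∏ᵢ (d_{i₀}/dᵢ) = U^k/∏dᵢ`.  The case `k = 0` is
   `V = 1 = C(∅)`.

References: P. T. Bateman, R. A. Horn, Math. Comp. 16 (1962), §2; G. H. Hardy, E. M. Wright,
Thm 429 (Mertens); the line card `Cruxes/RoughValueLaw/Lines/increment-anchoring.md`.
-/

noncomputable section

open Filter Finset Polynomial
open scoped Topology BigOperators
open Literature.NumberTheory.Sieve

namespace Summit.Parity.BatemanHorn.Cruxes.RoughValueLaw.IncrementAnchoring

namespace MertensAlongSystem

open Literature.NumberTheory.Sieve.BatemanHornMertens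

/-- **The empty system (`k = 0`).**  Every class count is `0`, so `V = 1`, and `C(∅) = 1` (every
Bateman–Horn partial product of the empty family is `1`): both sides are the constant `1`.
[folklore] -/
theorem tendsto_fin_zero (f : Fin 0 → ℤ[X]) (U : ℝ) :
    Tendsto (fun x : ℕ =>
      (∏ p ∈ Nat.primesBelow (x + 1),
          (1 - (((range p).filter (fun r : ℕ => ∃ i,
              (p : ℝ) < (x : ℝ) ^ (((f i).natDegree : ℝ) / U) ∧
                (p : ℤ) ∣ (f i).eval (r : ℤ))).card : ℝ) / (p : ℝ))) * Real.log x ^ 0)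
      atTop
      (𝓝 (batemanHornConst f / (∏ i, ((f i).natDegree : ℝ)) *
        Real.exp (-(((0 : ℕ) : ℝ) * Real.eulerMascheroniConstant)) * U ^ 0)) := by
  have h1 : (fun x : ℕ =>
      (∏ p ∈ Nat.primesBelow (x + 1),
          (1 - (((range p).filter (fun r : ℕ => ∃ i,
              (p : ℝ) < (x : ℝ) ^ (((f i).natDegree : ℝ) / U) ∧
                (p : ℤ) ∣ (f i).eval (r : ℤ))).card : ℝ) / (p : ℝ))) * Real.log x ^ 0) =
      fun _ => 1 := by
    funext x
    rw [pow_zero, mul_one]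
    refine prod_eq_one fun p _ => ?_
    simp
  -- `C(∅) = 1`
  have hC : batemanHornConst f = 1 := by
    apply HasBatemanHornConst.batemanHornConst_eq
    have h : batemanHornPartial f = fun _ => 1 := by
      funext x
      unfold batemanHornPartial
      refine prod_eq_one fun p hp => ?_
      have hp' := Nat.prime_of_mem_primesLE hp
      have h0 : polyRootCountMod f p = 0 := by
        unfold polyRootCountMod
        rw [card_eq_zero, filter_eq_empty_iff]
        intro n _ hdvd
        simp only [univ_eq_empty, prod_empty] at hdvd
        have h1 : (p : ℤ) = 1 := Int.eq_one_of_dvd_one (by positivity) hdvd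
        exact hp'.ne_one (by exact_mod_cast h1)
      simp [h0]
    rw [HasBatemanHornConst, h]
    exact tendsto_const_nhds
  rw [h1, hC]
  convert (tendsto_const_nhds : Tendsto (fun _ : ℕ => (1 : ℝ)) atTop (𝓝 1)) using 2
  simp

/-- **The case `k + 1` of `stub_mertensAlongSystem`** (steps 1–5 of the module docstring).
[folklore] -/
theorem tendsto_succ {k : ℕ} {f : Fin (k + 1) → ℤ[X]} (hf : IsBatemanHornSystem f) {U : ℝ}
    (hU : ((∑ i, (f i).natDegree : ℕ) : ℝ) ≤ U) :
    Tendsto (fun x : ℕ =>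
      (∏ p ∈ Nat.primesBelow (x + 1),
          (1 - (((range p).filter (fun r : ℕ => ∃ i,
              (p : ℝ) < (x : ℝ) ^ (((f i).natDegree : ℝ) / U) ∧
                (p : ℤ) ∣ (f i).eval (r : ℤ))).card : ℝ) / (p : ℝ))) * Real.log x ^ (k + 1))
      atTop
      (𝓝 (batemanHornConst f / (∏ i, ((f i).natDegree : ℝ)) *
        Real.exp (-(((k + 1 : ℕ) : ℝ) * Real.eulerMascheroniConstant)) * U ^ (k + 1))) := by
  -- degrees and exponents
  have hd : ∀ i, 0 < (f i).natDegree := hf.natDegree_pos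
  obtain ⟨i₀, -, hi₀⟩ := exists_min_image univ (fun i => (f i).natDegree) univ_nonempty
  have hDpos : 0 < ∑ i, (f i).natDegree := sum_pos (fun i _ => hd i) univ_nonempty
  have hU0 : 0 < U := lt_of_lt_of_le (by exact_mod_cast hDpos) hU
  have hdU : ∀ i, ((f i).natDegree : ℝ) ≤ U := fun i => by
    refine le_trans ?_ hU
    exact_mod_cast single_le_sum (f := fun j => (f j).natDegree) (fun j _ => Nat.zero_le _)
      (mem_univ i)
  have hc0 : ∀ i, 0 < ((f i).natDegree : ℝ) / U := fun i => div_pos (by exact_mod_cast hd i) hU0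
  have hc1 : ∀ i, ((f i).natDegree : ℝ) / U ≤ 1 := fun i => (div_le_one hU0).mpr (hdU i)
  have hci₀ : ∀ i, ((f i₀).natDegree : ℝ) / U ≤ ((f i).natDegree : ℝ) / U := fun i =>
    div_le_div_of_nonneg_right (by exact_mod_cast hi₀ i (mem_univ i)) hU0.le
  -- thresholds `mᵢ(x) = ⌈x^{dᵢ/U}⌉₊ − 1`
  have hm : ∀ i, Tendsto (fun x : ℕ => ⌈(x : ℝ) ^ (((f i).natDegree : ℝ) / U)⌉₊ - 1)
      atTop atTop := fun i => tendsto_ceil_rpow_sub_one_atTop (hc0 i)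
  have hl : ∀ i, Tendsto (fun x : ℕ =>
      Real.log ((⌈(x : ℝ) ^ (((f i).natDegree : ℝ) / U)⌉₊ - 1 : ℕ) : ℝ) / Real.log x) atTop
      (𝓝 (((f i).natDegree : ℝ) / U)) := fun i => tendsto_log_ceil_rpow_sub_one_div_log (hc0 i)
  -- (2) Mertens along `f` below `z_{i₀}`:
  -- the factor `A(x) = (log x)^{k+1} ∏_{p ≤ m_{i₀}} (1 − ω_f(p)/p)`
  have hA : Tendsto (fun x : ℕ => Real.log x ^ (k + 1) *
      ∏ p ∈ Nat.primesLE (⌈(x : ℝ) ^ (((f i₀).natDegree : ℝ) / U)⌉₊ - 1),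
        (1 - (polyRootCountMod f p : ℝ) / p)) atTop (𝓝 (batemanHornConst f *
      Real.exp (-(((k + 1 : ℕ) : ℝ) * Real.eulerMascheroniConstant)) *
      (((f i₀).natDegree : ℝ) / U)⁻¹ ^ (k + 1))) :=
    tendsto_log_pow_mul_comp (k + 1) (hc0 i₀) (tendsto_log_pow_mul_prod_one_sub_rootCount hf)
      (hm i₀) (hl i₀)
  -- (3) Mertens for the single polynomials on the windows `[z_{i₀}, zᵢ)`: the factor `B(x)`
  have hB : Tendsto (fun x : ℕ => ∏ i,
      (∏ p ∈ Nat.primesLE (⌈(x : ℝ) ^ (((f i).natDegree : ℝ) / U)⌉₊ - 1),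
          (1 - (polyRootCountMod ![f i] p : ℝ) / p)) /
        ∏ p ∈ Nat.primesLE (⌈(x : ℝ) ^ (((f i₀).natDegree : ℝ) / U)⌉₊ - 1),
          (1 - (polyRootCountMod ![f i] p : ℝ) / p)) atTop
      (𝓝 (∏ i, (((f i₀).natDegree : ℝ) / U) / (((f i).natDegree : ℝ) / U))) := by
    refine tendsto_finsetProd _ fun i _ => ?_
    have hCi := (IsBatemanHornSystem.hasBatemanHornConst_holds (isBatemanHornSystem_single hf i)).2
    exact tendsto_div_comp_of_log_mul (mul_ne_zero hCi.ne' (Real.exp_pos _).ne') (hc0 i)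
      (tendsto_log_mul_prod_one_sub_rootCount_single (isBatemanHornSystem_single hf i))
      (hm i) (hm i₀) (hl i) (hl i₀)
  -- (4) the correction product tends to `1`
  obtain ⟨P₀, hP₀⟩ := hf.exists_polyRootCountMod_eq_sum
  have hE : Tendsto (fun x : ℕ => ∏ p ∈ Nat.primesLE x \
      Nat.primesLE (⌈(x : ℝ) ^ (((f i₀).natDegree : ℝ) / U)⌉₊ - 1),
    ((1 - (((range p).filter (fun r : ℕ => ∃ i,
        (p : ℝ) < (x : ℝ) ^ (((f i).natDegree : ℝ) / U) ∧
          (p : ℤ) ∣ (f i).eval (r : ℤ))).card : ℝ) / (p : ℝ)) /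
      ∏ i ∈ univ.filter (fun i => (p : ℝ) < (x : ℝ) ^ (((f i).natDegree : ℝ) / U)),
        (1 - (polyRootCountMod ![f i] p : ℝ) / p))) atTop (𝓝 1) := by
    have h1 : Tendsto (fun x : ℕ =>
        ((⌈(x : ℝ) ^ (((f i₀).natDegree : ℝ) / U)⌉₊ - 1 : ℕ) : ℝ) + 1) atTop atTop :=
      tendsto_atTop_add_const_right _ 1 (tendsto_natCast_atTop_atTop.comp (hm i₀))
    have hlow : Tendsto (fun x : ℕ => 1 - 4 * (((∑ i, (f i).natDegree : ℕ) : ℝ)) ^ 2 /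
        (((⌈(x : ℝ) ^ (((f i₀).natDegree : ℝ) / U)⌉₊ - 1 : ℕ) : ℝ) + 1)) atTop (𝓝 1) := by
      simpa using tendsto_const_nhds.sub (tendsto_const_nhds.div_atTop h1)
    have hev : ∀ᶠ x : ℕ in atTop, P₀ ≤ ⌈(x : ℝ) ^ (((f i₀).natDegree : ℝ) / U)⌉₊ - 1 :=
      (hm i₀).eventually (eventually_ge_atTop P₀)
    refine tendsto_of_tendsto_of_tendsto_of_le_of_le' hlow tendsto_const_nhds ?_ ?_
    · filter_upwards [hev] with x hx
      exact (corr_prod_bounds hf (fun i => (x : ℝ) ^ (((f i).natDegree : ℝ) / U)) _ x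
        (fun p hp hlt => hP₀ p hp (lt_of_le_of_lt hx hlt))).1
    · filter_upwards [hev] with x hx
      exact (corr_prod_bounds hf (fun i => (x : ℝ) ^ (((f i).natDegree : ℝ) / U)) _ x
        (fun p hp hlt => hP₀ p hp (lt_of_le_of_lt hx hlt))).2
  -- (5) assembly
  have hlim := (hA.mul hB).mul hE
  have hval : batemanHornConst f *
        Real.exp (-(((k + 1 : ℕ) : ℝ) * Real.eulerMascheroniConstant)) *
        (((f i₀).natDegree : ℝ) / U)⁻¹ ^ (k + 1) *
      (∏ i, (((f i₀).natDegree : ℝ) / U) / (((f i).natDegree : ℝ) / U)) * 1 =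
      batemanHornConst f / (∏ i, ((f i).natDegree : ℝ)) *
        Real.exp (-(((k + 1 : ℕ) : ℝ) * Real.eulerMascheroniConstant)) * U ^ (k + 1) := by
    have hd0 : ∀ i, ((f i).natDegree : ℝ) ≠ 0 := fun i => by exact_mod_cast (hd i).ne'
    have hUne : U ≠ 0 := hU0.ne'
    have hP : ∏ i, ((f i).natDegree : ℝ) ≠ 0 := prod_ne_zero_iff.mpr fun i _ => hd0 i
    have hd₀ : ((f i₀).natDegree : ℝ) ≠ 0 := hd0 i₀
    have hprod : ∏ i, (((f i₀).natDegree : ℝ) / U) / (((f i).natDegree : ℝ) / U) =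
        ((f i₀).natDegree : ℝ) ^ (k + 1) / ∏ i, ((f i).natDegree : ℝ) := by
      rw [prod_div_distrib, prod_const, card_univ, Fintype.card_fin, prod_div_distrib, prod_const,
        card_univ, Fintype.card_fin, div_pow, div_div_div_cancel_right₀ (pow_ne_zero _ hUne)]
    rw [hprod, mul_one, inv_div, div_pow]
    field_simp
  rw [hval] at hlim
  refine hlim.congr' ?_
  filter_upwards [eventually_ge_atTop 1] with x hx
  have hx1 : (1 : ℝ) ≤ x := by exact_mod_cast hx
  have hzx : ∀ i, (x : ℝ) ^ (((f i).natDegree : ℝ) / U) ≤ x := fun i => by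
    simpa using Real.rpow_le_rpow_of_exponent_le hx1 (hc1 i)
  rw [prod_one_sub_card_div_eq hf (fun i => (x : ℝ) ^ (((f i).natDegree : ℝ) / U)) i₀
    (fun i => Real.rpow_le_rpow_of_exponent_le hx1 (hci₀ i)) hzx]
  ring

end MertensAlongSystem

/-- **S1b — `stub_mertensAlongSystem`: Mertens' theorem along a Bateman–Horn system with staggered
thresholds.**  For every Bateman–Horn system `f` of `k` polynomials and every FIXED depth
`U ≥ ∑ᵢ deg fᵢ` (so that `zᵢ = x^{deg fᵢ/U} ≤ x`), as `x → ∞`,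
`V_f(x,U)·(log x)^k → (C(f)/∏ deg fᵢ)·e^{−kγ}·U^k`, where
`V_f(x,U) = ∏_{p ≤ x prime} (1 − ω_f(x,U;p)/p)`,
`ω_f(x,U;p) = #{0 ≤ r < p : ∃ i, p < x^{deg fᵢ/U} ∧ p ∣ fᵢ(r)}` and `C(f) = batemanHornConst f`.
Proof: `MertensAlongSystem.tendsto_succ` (Mertens along `f` below `z_min`, Mertens for the single
polynomials on the windows `[z_min, zᵢ)`, and the correction product `→ 1`) and
`MertensAlongSystem.tendsto_fin_zero` (`k = 0`). [folklore] -/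
theorem stub_mertensAlongSystem :
    ∀ (k : ℕ) (f : Fin k → Polynomial ℤ), IsBatemanHornSystem f →
      ∀ U : ℝ, ((∑ i, (f i).natDegree : ℕ) : ℝ) ≤ U →
        Tendsto (fun x : ℕ =>
          (∏ p ∈ Nat.primesBelow (x + 1),
              (1 - (((range p).filter (fun r : ℕ => ∃ i,
                  (p : ℝ) < (x : ℝ) ^ (((f i).natDegree : ℝ) / U) ∧
                    (p : ℤ) ∣ (f i).eval (r : ℤ))).card : ℝ) / (p : ℝ))) * Real.log x ^ k)
          atTop
          (𝓝 (batemanHornConst f / (∏ i, ((f i).natDegree : ℝ)) *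
            Real.exp (-((k : ℝ) * Real.eulerMascheroniConstant)) * U ^ k)) := by
  intro k f hf U hU
  cases k with
  | zero => exact MertensAlongSystem.tendsto_fin_zero f U
  | succ k => exact MertensAlongSystem.tendsto_succ hf hU

end Summit.Parity.BatemanHorn.Cruxes.RoughValueLaw.IncrementAnchoring

end
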